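import Literature.AlgebraicGeometry.Resolution.BlowupSequencesPrune
import Literature.AlgebraicGeometry.Resolution.StrictTransformDistinct
import HarnessLib

/-!
# Transforms of marked ideals along a pruned blow-up sequence (Kollár 2007, 3.32 / 3.34.1 with Def. 3.66)

Topic: `Literature/AlgebraicGeometry/Resolution`. Shared infrastructure for the decomposition of
the named facts `Kollar2007Thm3_103` / `Kollar2007Thm3_107` (`KollarBlowupSequenceFunctors.lean`;
J. Kollár, *Lectures on Resolution of Singularities*, 2007, Ch. 3), continuing
`BlowupSequencesPrune.lean`. The second bullet of the functoriality package 3.34.1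
(`Kollar2007.CommutesWithSmoothMorphisms`) compares a functor's value on a pulled-back triple
with the pull-back of its value after DELETING THE EMPTY BLOW-UPS (`CentreSeq.prune`). To
compose functors (3.104, 3.111) one must therefore compare the data `(X_r, I_r, E_r)`
(Def. 3.66, `CentreSeq.transformMarked`) at the top of a sequence `s` with the data at the top
of `s.prune`, along the identification `s.pruneι : s.prune.top ⟶ s.top`. This file PROVES:

* `controlledTransform_of_eq_top`, `strictTransformIdeal_of_eq_top`,
  `MarkedIdeal.transform_of_eq_top` — **an empty blow-up transforms `(X, I, m, E)` into
  `(X', I·𝒪_{X'}, m, E·𝒪_{X'} ⧺ [∅])`**: the controlled and strict transforms along a blow-up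
  with empty centre are the total transforms, and the only change is the new EMPTY member of the
  boundary (Kollár 3.32: such steps "are then ignored without explicit mention");
* `comap_eq_top_iff_of_surjective`, `removeEmpty_map_comap_of_surjective` — pulling back
  along a surjection reflects the empty divisor, so deleting empty members commutes with it;
* `transformMarked_congr` (transport along an equality of sequences) and
  `transformMarked_congr_removeEmpty` — **marked ideals with the same ideal, marking and
  non-empty boundary members have transforms with the same ideal, marking and non-empty
  boundary members** (the strict transform of the empty divisor is empty,
  `strictTransformIdeal_top`);
* **`transformMarked_prune`** — along `s.prune` the transform of `M` has ideal
  `(I_r)·𝒪` pulled back along `pruneι`, the same marking, and, up to deleting empty members, the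
  boundary `E_r` pulled back along `pruneι`: the two triples "at the top" that clause (3)
  `IgnoresEmptyDivisors` of the functoriality package is designed to identify.

## Sources

* J. Kollár, *Lectures on Resolution of Singularities* (2007): 3.32 (p. 130), 3.34.1 (p. 131),
  Def. 3.65–3.66 (p. 149). [Kollar2007]
* E. Bierstone, D. Grigoriev, P. Milman, J. Włodarczyk, arXiv:1206.3090, Def. 3.1.3 (3)–(5)
  (transforms), Thm. 8.0.5 (induced sequences) — the tree's vocabulary.
  [BierstoneGrigorievMilmanWlodarczyk2011]
-/

noncomputable section

open CategoryTheory CategoryTheory.Limits AlgebraicGeometry TopologicalSpace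

namespace Literature.AlgebraicGeometry.Resolution

universe u

/-! ## Transforms along an empty blow-up -/

section EmptyCentre

variable {X X' : Scheme.{u}} (π : X' ⟶ X) {C : X.IdealSheafData}

/-- Along a blow-up with empty centre the controlled transform is the total transform.
[cite: Kollar2007, 3.32 (p. 130)] -/
theorem controlledTransform_of_eq_top (hC : C = ⊤) (I : X.IdealSheafData) (μ : ℕ) :
    controlledTransform π C I μ = I.comap π := by
  subst hC
  rw [controlledTransform, Scheme.IdealSheafData.comap_top, ← Scheme.IdealSheafData.one_eq_top,
    one_pow, Scheme.IdealSheafData.one_eq_top, colon_top]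

/-- Along a blow-up with empty centre the strict transform is the total transform.
[cite: Kollar2007, 3.32 (p. 130)] -/
theorem strictTransformIdeal_of_eq_top (hC : C = ⊤) (K : X.IdealSheafData) :
    strictTransformIdeal π C K = K.comap π := by
  subst hC
  rw [strictTransformIdeal]
  have : ∀ n : ℕ, colon (K.comap π) (((⊤ : X.IdealSheafData).comap π) ^ n) = K.comap π := by
    intro n
    rw [Scheme.IdealSheafData.comap_top, ← Scheme.IdealSheafData.one_eq_top, one_pow,
      Scheme.IdealSheafData.one_eq_top, colon_top]
  simp_rw [this]
  exact iSup_const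

/-- **An empty blow-up transforms `(X, I, m, E)` into `(X', I·𝒪_{X'}, m, E·𝒪_{X'} ⧺ [∅])`**: the
pulled-back marked ideal with one more, EMPTY, boundary member. [cite: Kollar2007, 3.32 (p. 130) with Def. 3.65–3.66 (p. 149)] -/
theorem MarkedIdeal.transform_of_eq_top (hC : C = ⊤) (M : MarkedIdeal X) :
    M.transform π C = ⟨(M.comap π).ideal, (M.comap π).boundary ++ [⊤], M.mult⟩ := by
  have hb : M.boundary.map (strictTransformIdeal π C) = M.boundary.map fun D => D.comap π :=
    List.map_congr_left fun D _ => strictTransformIdeal_of_eq_top π hC D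
  simp only [MarkedIdeal.transform, controlledTransform_of_eq_top π hC, hb, MarkedIdeal.comap]
  subst hC
  rw [Scheme.IdealSheafData.comap_top]

end EmptyCentre

/-! ## Deleting empty members and pulling back along a surjection -/

section Surjective

variable {X Y : Scheme.{u}} (f : Y ⟶ X)

/-- Pulling back along a surjection reflects the empty divisor. [folklore] -/
theorem comap_eq_top_iff_of_surjective [Surjective f] (D : X.IdealSheafData) :
    D.comap f = ⊤ ↔ D = ⊤ := by
  refine ⟨fun h => ?_, fun h => by rw [h, Scheme.IdealSheafData.comap_top]⟩
  rw [← Scheme.IdealSheafData.support_eq_bot_iff] at h ⊢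
  rw [Scheme.IdealSheafData.support_comap] at h
  ext x
  obtain ⟨y, rfl⟩ := f.surjective x
  simp only [TopologicalSpace.Closeds.coe_bot, Set.mem_empty_iff_false, iff_false]
  intro hx
  have hy : y ∈ (D.support.preimage f.continuous : Set Y) := hx
  rw [h] at hy
  simp at hy

/-- Hence deleting the empty members commutes with pulling a boundary back along a surjection.
[folklore] -/
theorem removeEmpty_map_comap_of_surjective [Surjective f] :
    ∀ E : List X.IdealSheafData,
      Kollar2007.removeEmpty (E.map fun D => D.comap f) =
        (Kollar2007.removeEmpty E).map fun D => D.comap f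
  | [] => rfl
  | D :: E => by
    by_cases hD : D = ⊤
    · subst hD
      rw [List.map_cons, Scheme.IdealSheafData.comap_top, Kollar2007.removeEmpty_cons_top,
        Kollar2007.removeEmpty_cons_top, removeEmpty_map_comap_of_surjective E]
    · have hD' : D.comap f ≠ ⊤ := fun h => hD ((comap_eq_top_iff_of_surjective f D).mp h)
      rw [List.map_cons, Kollar2007.removeEmpty_cons_of_ne_top hD',
        Kollar2007.removeEmpty_cons_of_ne_top hD, List.map_cons, removeEmpty_map_comap_of_surjective E]

/-- Deleting the empty members after pulling back in two steps, the second one surjective.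
[folklore] -/
theorem removeEmpty_map_comap_comp {Z W : Scheme.{u}} (a : Z ⟶ X) (b : W ⟶ Z) [Surjective b]
    (L : List X.IdealSheafData) (L' : List Z.IdealSheafData)
    (h : Kollar2007.removeEmpty L' = Kollar2007.removeEmpty (L.map fun D => D.comap a)) :
    Kollar2007.removeEmpty (L'.map fun D => D.comap b) =
      Kollar2007.removeEmpty (L.map fun D => D.comap (b ≫ a)) := by
  have hc : (fun D : X.IdealSheafData => D.comap (b ≫ a)) =
      (fun D : Z.IdealSheafData => D.comap b) ∘ fun D => D.comap a := by
    funext D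
    simp [Scheme.IdealSheafData.comap_comp]
  rw [removeEmpty_map_comap_of_surjective b L', h, ← removeEmpty_map_comap_of_surjective b, hc,
    List.comp_map]

end Surjective

/-- Deleting the empty members commutes, up to deleting again, with any map of boundaries fixing
the empty divisor (a private copy of the statement in `KollarTripleSequence.lean`, which this
file does not import). [folklore] -/
private theorem removeEmpty_map_of_map_top' {X Y : Scheme.{u}}
    (f : X.IdealSheafData → Y.IdealSheafData) (hf : f ⊤ = ⊤) :
    ∀ E : List X.IdealSheafData,
      Kollar2007.removeEmpty (E.map f) = Kollar2007.removeEmpty ((Kollar2007.removeEmpty E).map f)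
  | [] => rfl
  | D :: E => by
    by_cases hD : D = ⊤
    · subst hD
      rw [List.map_cons, hf, Kollar2007.removeEmpty_cons_top, Kollar2007.removeEmpty_cons_top,
        removeEmpty_map_of_map_top' f hf E]
    · rw [List.map_cons, Kollar2007.removeEmpty_cons_of_ne_top hD, List.map_cons]
      by_cases hfD : f D = ⊤
      · rw [hfD, Kollar2007.removeEmpty_cons_top, Kollar2007.removeEmpty_cons_top,
          removeEmpty_map_of_map_top' f hf E]
      · rw [Kollar2007.removeEmpty_cons_of_ne_top hfD, Kollar2007.removeEmpty_cons_of_ne_top hfD,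
          removeEmpty_map_of_map_top' f hf E]

namespace CentreSeq

variable {X : Scheme.{u}}

/-! ## Congruences for the transform along a sequence -/

/-- Transport of the final transform along an equality of sequences. [folklore] -/
theorem transformMarked_congr {s₁ s₂ : CentreSeq X} (e : s₁ = s₂) (M : MarkedIdeal X) :
    s₁.transformMarked M = (s₂.transformMarked M).comap (eqToHom (congrArg top e)) := by
  subst e
  simp

/-- **Marked ideals with the same ideal, marking and non-empty boundary members have final
transforms with the same ideal, marking and non-empty boundary members** (the transform of the
ideal does not see the boundary; the strict transform of the empty divisor is empty,
`strictTransformIdeal_top`). [cite: Kollar2007, 3.32 (p. 130), Notation 3.64 (3) (p. 148)] -/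
theorem transformMarked_congr_removeEmpty : ∀ {X : Scheme.{u}} (s : CentreSeq X)
    {M₁ M₂ : MarkedIdeal X}, M₁.ideal = M₂.ideal → M₁.mult = M₂.mult →
    Kollar2007.removeEmpty M₁.boundary = Kollar2007.removeEmpty M₂.boundary →
      (s.transformMarked M₁).ideal = (s.transformMarked M₂).ideal ∧
        (s.transformMarked M₁).mult = (s.transformMarked M₂).mult ∧
        Kollar2007.removeEmpty (s.transformMarked M₁).boundary =
          Kollar2007.removeEmpty (s.transformMarked M₂).boundary
  | _, nil _, _, _, h₁, h₂, h₃ => ⟨h₁, h₂, h₃⟩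
  | _, cons C rest, M₁, M₂, h₁, h₂, h₃ => by
    rw [transformMarked_cons, transformMarked_cons]
    refine transformMarked_congr_removeEmpty rest ?_ ?_ ?_
    · simp only [MarkedIdeal.transform_ideal, h₁, h₂]
    · simpa using h₂
    · simp only [MarkedIdeal.transform_boundary, Kollar2007.removeEmpty_append]
      rw [removeEmpty_map_of_map_top' _ (strictTransformIdeal_top _ _) M₁.boundary,
        removeEmpty_map_of_map_top' _ (strictTransformIdeal_top _ _) M₂.boundary, h₃]

/-! ## The transform along the pruned sequence -/

/-- **The transform of `M` along `s.prune`, compared with the transform along `s`** through the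
identification `s.pruneι : s.prune.top ⟶ s.top`: the ideal is the pull-back of the final ideal,
the marking is the same, and the boundary has, after deleting the empty members, the pulled-back
non-empty members of the final boundary (the deleted empty blow-ups contribute only empty
members, `MarkedIdeal.transform_of_eq_top`; the rest is moved along isomorphisms,
`transformMarked_comap`). For `X` locally Noetherian.
[cite: Kollar2007, 3.34.1 (p. 131) with 3.32 (p. 130)] -/
theorem transformMarked_prune : ∀ {X : Scheme.{u}} [IsLocallyNoetherian X] (s : CentreSeq X)
    (M : MarkedIdeal X),
    (s.prune.transformMarked M).ideal = (s.transformMarked M).ideal.comap s.pruneι ∧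
      (s.prune.transformMarked M).mult = (s.transformMarked M).mult ∧
      Kollar2007.removeEmpty (s.prune.transformMarked M).boundary =
        Kollar2007.removeEmpty ((s.transformMarked M).boundary.map fun D => D.comap s.pruneι)
  | X, _, nil _, M => by
    refine ⟨?_, rfl, ?_⟩
    · show M.ideal = M.ideal.comap (𝟙 X)
      rw [Scheme.IdealSheafData.comap_id]
    · show Kollar2007.removeEmpty M.boundary =
        Kollar2007.removeEmpty (M.boundary.map fun D => D.comap (𝟙 X))
      congr 1
      conv_lhs => rw [← List.map_id M.boundary]
      exact List.map_congr_left fun D _ => (Scheme.IdealSheafData.comap_id D).symm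
  | X, _, cons C rest, M => by
    haveI : IsLocallyNoetherian (blowup C) := isLocallyNoetherian_blowup C
    by_cases hC : C = ⊤
    · -- an empty first blow-up, deleted by `prune`
      haveI := isIso_blowup_π_of_eq_top hC
      have e := prune_cons_of_eq_top hC rest
      set P := rest.prune with hPdef
      set ι := inv (blowup.π C) with hιdef
      -- the hypothesis side: transforms along `rest` of `M⁺ = (M·𝒪, E·𝒪 ⧺ [∅])`
      have hM : M.transform (blowup.π C) C =
          ⟨(M.comap (blowup.π C)).ideal, (M.comap (blowup.π C)).boundary ++ [⊤], M.mult⟩ :=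
        MarkedIdeal.transform_of_eq_top (blowup.π C) hC M
      obtain ⟨ih₁, ih₂, ih₃⟩ := transformMarked_prune rest (M.transform (blowup.π C) C)
      obtain ⟨hc₁, hc₂, hc₃⟩ := transformMarked_congr_removeEmpty P
        (M₁ := M.transform (blowup.π C) C) (M₂ := M.comap (blowup.π C))
        (by rw [hM]) (by rw [hM]; rfl) (by rw [hM]; simp)
      -- the conclusion side: transforms along `P.comap ι`, moved along `eqToHom`
      have hM' : M = (M.comap (blowup.π C)).comap ι := by
        rw [← MarkedIdeal.comap_comp, hιdef, IsIso.inv_hom_id, MarkedIdeal.comap_id]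
      have key : (cons C rest).prune.transformMarked M =
          ((P.transformMarked (M.comap (blowup.π C))).comap (P.comapι ι)).comap
            (eqToHom (congrArg top e)) := by
        rw [transformMarked_congr e, ← transformMarked_comap, ← hM']
      have hι : (cons C rest).pruneι = eqToHom (congrArg top e) ≫ P.comapι ι ≫ rest.pruneι :=
        pruneι_cons_of_eq_top hC rest
      haveI : IsIso (P.comapι ι) :=
        comapι_mem (MorphismProperty.isomorphisms Scheme.{u}) (fun g (_ : IsIso g) => inferInstance)
          P ι (inferInstance : IsIso ι)
      haveI : Surjective (eqToHom (congrArg top e) ≫ P.comapι ι) := inferInstance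
      rw [key, hι, transformMarked_cons]
      dsimp only [top_cons]
      refine ⟨?_, ?_, ?_⟩
      · rw [MarkedIdeal.comap_ideal, MarkedIdeal.comap_ideal,
          Scheme.IdealSheafData.comap_comp, Scheme.IdealSheafData.comap_comp, ← ih₁, hc₁]
      · rw [MarkedIdeal.comap_mult, MarkedIdeal.comap_mult, ← ih₂, hc₂]
      · simp only [MarkedIdeal.comap_boundary, List.map_map]
        have hcomp : ((fun D => D.comap (eqToHom (congrArg top e))) ∘ fun D => D.comap (P.comapι ι)) =
            fun D : P.top.IdealSheafData => D.comap (eqToHom (congrArg top e) ≫ P.comapι ι) := by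
          funext D
          simp [Scheme.IdealSheafData.comap_comp]
        have hcomp' : (fun D : rest.top.IdealSheafData =>
            D.comap (eqToHom (congrArg top e) ≫ P.comapι ι ≫ rest.pruneι)) =
            (fun D => D.comap (eqToHom (congrArg top e) ≫ P.comapι ι)) ∘ fun D => D.comap rest.pruneι := by
          funext D
          simp [Scheme.IdealSheafData.comap_comp]
        rw [hcomp, hcomp', ← List.map_map,
          removeEmpty_map_comap_of_surjective, removeEmpty_map_comap_of_surjective, ← ih₃, hc₃]
    · -- a non-empty first blow-up, kept by `prune`
      have e := prune_cons_of_ne_top hC rest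
      have key : (cons C rest).prune.transformMarked M =
          (rest.prune.transformMarked (M.transform (blowup.π C) C)).comap
            (eqToHom (congrArg top e) : (cons C rest).prune.top ⟶ rest.prune.top) := by
        rw [transformMarked_congr e, transformMarked_cons]
        rfl
      have hι : (cons C rest).pruneι = eqToHom (congrArg top e) ≫ rest.pruneι :=
        pruneι_cons_of_ne_top hC rest
      obtain ⟨ih₁, ih₂, ih₃⟩ := transformMarked_prune rest (M.transform (blowup.π C) C)
      rw [key, hι, transformMarked_cons]
      dsimp only [top_cons]
      refine ⟨?_, ?_, ?_⟩
      · rw [MarkedIdeal.comap_ideal, Scheme.IdealSheafData.comap_comp, ih₁]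
      · rw [MarkedIdeal.comap_mult, ih₂]
      · simp only [MarkedIdeal.comap_boundary]
        exact removeEmpty_map_comap_comp _ _ _ _ ih₃

end CentreSeq

end Literature.AlgebraicGeometry.Resolution

end
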